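import Mathlib
import Summits.NavierStokesRegularity.NavierStokesRegularity.Theorems.SoloInformedIncomingNode

/-!
# Kelvin versus Yomdin: no smooth sub-Leray self-similar Euler profiles — the typed skeleton

Solo seat `solo-NavierStokesRegularity-informed` (session 9; self-contained note
`paper/no-smooth-subleray-profiles.md`, CLAIMS C52–C55). Context for Clay (A): an exactly
self-similar Euler profile `u = (T-t)^{γ-1} U(x/(T-t)^γ)` can drive a Navier–Stokes singularity only
for `γ < 1/2` (viscosity is then asymptotically invisible, factor `(T-t)^{1-2γ}`), cf.
`collapseRate_le_half`. Profile equations: `(1-γ)U + γ(y·∇)U + (U·∇)U + ∇P = 0` on `ℝ³`,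
`V := γ y + U`, `N_V := {V = 0}`, far-field hypothesis (F): `y·U(y) ≥ -(γ/2)|y|²` for `|y| ≥ R₀`
(implied by `|U(y)| = o(|y|)`, the standing class of Constantin–Ignatova–Vicol, arXiv:2602.17570, §3).

THEOREM 1 (hand proof in the note, NOT formalised here). `0 < γ < 1/2`, `U ∈ C^∞`, (F) ⇒ `curl U ≡ 0`
(so `U ≡ 0` if `div U = 0`, `U(0) = 0`, `|U| = o(|y|)`). THEOREM 2. `U ∈ C^k`, `1 ≤ k < ∞`, (F),
`curl U ≢ 0` ⇒ `k(1-2γ) ≤ ρ* := max_{y* ∈ N_V} (max Re spec (-∇V(y*)))`: some node carries an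
eigenvalue of real part `≤ -k(1-2γ)`. This removes all three extra hypotheses (local outgoing
property, real-analyticity of `Ω` at the nodes, finiteness of `N_V`) from [CIV, Thm 3.10] for smooth
profiles and turns them into a quantitative regularity ceiling for `C^k` ones.
PROOF SHAPE. (K) self-similar Kelvin law `Γ(τ) = e^{(2γ-1)τ}Γ(0)` for loops transported by `V`;
(C) (F) makes every ball `B̄_R`, `R ≥ R₀`, backward invariant, so a loop with `Γ(0) ≠ 0` has backward
images of length `≥ (|Γ(0)|/max|U|) e^{(1-2γ)n}`; (B) the Bernoulli function
`H = ½|V|² + P - ½γ(1-γ)|y|²` has `V·∇H = (2γ-1)|V|²`, a strict Lyapunov function, so for the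
(torus-compactified) backward time-one map every recurrent point is fixed
(`fixed_of_recurrent_of_lyapunov` below), every invariant measure sits on fixed points, and
`h_top = 0` by the variational principle; Yomdin's theorem (Israel J. Math. 57 (1987); Pollicott,
LMS LN 180, Thm 6.1): `limsup (1/n) log length(fⁿ C₀) ≤ h_top(f) + (1/k) log λ(f)` for `C^k`, `≤ h_top`
for `C^∞`; and a uniform growth lemma `log λ(f) ≤ ρ*` (frozen coefficients + the time budget away
from the nodes). The move is the anti-fast-dynamo bound of Vishik (1989) / Klapper–Young (CMP 173
(1995)) transplanted to self-similar profiles, where growth is FORCED by (K) and entropy is KILLED by (B).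
WHAT IS FORMALISED: the dynamical core of Step 1 (`fixed_of_recurrent_of_lyapunov`: a continuous map
with a continuous Lyapunov function, strict off the fixed points, has only fixed recurrent points),
the concluding rate bookkeeping (`regularityCeiling_of_kelvin_yomdin`: (K)+(C) lower bound and the
Yomdin/uniform-growth upper bound with `h_top = 0` give `k(1-2γ) ≤ ρ`; `half_le_of_kelvin_yomdin_smooth`:
the `C^∞` case gives `1/2 ≤ γ`), the corollaries (`regularity_bound`,
`no_profile_of_spectrally_nonincoming` = [CIV, Thm 3.10] without analyticity,
`complexPair_not_compressive` / `realPair_at_compressive_node` = the spectrum at a compressive node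
carrying vorticity is real), and the exact singular swirl `U = κ r^{1-1/γ} e_θ` of the note's §4
(`powerLawSwirl_profile`, `powerLawSwirl_kelvin_exponent`, `powerLawSwirl_exponent_neg`), which
solves the profile equation for every `γ` and shows where the smoothness hypothesis bites (it is
unbounded at the node). NOT formalised: flows, line integrals, (K), (B), (C), Yomdin's theorem.
[new combination: [ConstantinIgnatovaVicol2026Euler] §3 × Yomdin 1987 / Klapper–Young 1995]
-/

namespace Summit.NavierStokesRegularity.NavierStokesRegularity.Theorems

open Filter Topology

/-- **Step 1 of Theorem 1 (dynamical core).** Let `f` be a self-map of a topological space and `H` a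
continuous function with `H ≤ H ∘ f` everywhere and `H y < H (f y)` whenever `f y ≠ y`. Then every
recurrent point of `f` (some sequence of iterates `f^[n j] x`, `n j ≥ 1`, converges to `x`) is a fixed
point. (Applied to the backward time-one map of the similarity flow with the Bernoulli function:
every invariant probability measure is carried by the stagnation set, hence `h_top = 0`.) -/
theorem fixed_of_recurrent_of_lyapunov {X : Type*} [TopologicalSpace X] (f : X → X) (H : X → ℝ)
    (hH : Continuous H) (hmono : ∀ y, H y ≤ H (f y)) (hstrict : ∀ y, f y ≠ y → H y < H (f y))
    {x : X} (n : ℕ → ℕ) (hn : ∀ j, 1 ≤ n j)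
    (hrec : Tendsto (fun j => f^[n j] x) atTop (𝓝 x)) : f x = x := by
  by_contra hx
  have hlt : H x < H (f x) := hstrict x hx
  have hiter : ∀ (m : ℕ) (y : X), H y ≤ H (f^[m] y) := by
    intro m
    induction m with
    | zero => intro y; simp
    | succ m ih =>
      intro y
      calc H y ≤ H (f y) := hmono y
        _ ≤ H (f^[m] (f y)) := ih (f y)
        _ = H (f^[m + 1] y) := by rw [Function.iterate_succ_apply]
  have horbit : ∀ j, H (f x) ≤ H (f^[n j] x) := by
    intro j
    obtain ⟨m, hm⟩ : ∃ m, n j = m + 1 := ⟨n j - 1, (Nat.sub_add_cancel (hn j)).symm⟩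
    rw [hm, Function.iterate_succ_apply]
    exact hiter m (f x)
  have hconv : Tendsto (fun j => H (f^[n j] x)) atTop (𝓝 (H x)) := (hH.tendsto x).comp hrec
  obtain ⟨j, hj⟩ := (hconv.eventually (Iio_mem_nhds hlt)).exists
  exact absurd (horbit j) (not_le.mpr hj)

/-- **Theorem 2, concluding step.** `ℓ σ` is the length of the loop transported backward for time `σ`.
(hK): Kelvin's law and `|∮ U·dl| ≤ max|U| · length` give `|Γ₀| e^{(1-2γ)σ} ≤ M ℓ σ`; (hY): Yomdin's
`C^k` inequality with the uniform growth bound `log λ(f) ≤ ρ` and entropy `h`: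
`ℓ σ ≤ C_ε e^{(h + ρ/k + ε)σ}` for every `ε > 0`; (hh): `h = 0` by the Lyapunov structure.
Conclusion: `k(1-2γ) ≤ ρ`. -/
theorem regularityCeiling_of_kelvin_yomdin {γ ρ k h Γ₀ M : ℝ} (ℓ : ℝ → ℝ) (hΓ₀ : Γ₀ ≠ 0)
    (hM : 0 ≤ M) (hk : 0 < k) (hh : h = 0)
    (hK : ∀ σ : ℝ, 0 ≤ σ → |Γ₀| * Real.exp ((1 - 2 * γ) * σ) ≤ M * ℓ σ)
    (hY : ∀ ε : ℝ, 0 < ε → ∃ C : ℝ, ∀ σ : ℝ, 0 ≤ σ →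
      ℓ σ ≤ C * Real.exp ((h + ρ / k + ε) * σ)) :
    k * (1 - 2 * γ) ≤ ρ := by
  subst hh
  have h1 : 1 - 2 * γ ≤ ρ / k := by
    refine le_of_forall_pos_le_add fun ε hε => ?_
    obtain ⟨C, hC⟩ := hY ε hε
    refine rate_le_of_exp_dominated (abs_pos.mpr hΓ₀) (C := M * C) fun σ hσ => ?_
    calc |Γ₀| * Real.exp ((1 - 2 * γ) * σ) ≤ M * ℓ σ := hK σ hσ
      _ ≤ M * (C * Real.exp ((0 + ρ / k + ε) * σ)) := mul_le_mul_of_nonneg_left (hC σ hσ) hM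
      _ = M * C * Real.exp ((ρ / k + ε) * σ) := by rw [zero_add]; ring
  calc k * (1 - 2 * γ) ≤ k * (ρ / k) := mul_le_mul_of_nonneg_left h1 hk.le
    _ = ρ := by field_simp

/-- **Theorem 1, concluding step (`C^∞`).** With Yomdin's `C^∞` inequality and `h_top = 0` the length
grows slower than every exponential (hY); Kelvin's forced growth (hK) then gives `1 - 2γ ≤ 0`, i.e.
no such loop exists when `γ < 1/2`: a smooth profile in the window has `curl U ≡ 0`. -/
theorem half_le_of_kelvin_yomdin_smooth {γ Γ₀ M : ℝ} (ℓ : ℝ → ℝ) (hΓ₀ : Γ₀ ≠ 0) (hM : 0 ≤ M)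
    (hK : ∀ σ : ℝ, 0 ≤ σ → |Γ₀| * Real.exp ((1 - 2 * γ) * σ) ≤ M * ℓ σ)
    (hY : ∀ ε : ℝ, 0 < ε → ∃ C : ℝ, ∀ σ : ℝ, 0 ≤ σ → ℓ σ ≤ C * Real.exp (ε * σ)) :
    1 / 2 ≤ γ := by
  have h1 : 1 - 2 * γ ≤ 0 := by
    refine le_of_forall_pos_le_add fun ε hε => ?_
    obtain ⟨C, hC⟩ := hY ε hε
    refine rate_le_of_exp_dominated (abs_pos.mpr hΓ₀) (C := M * C) fun σ hσ => ?_
    calc |Γ₀| * Real.exp ((1 - 2 * γ) * σ) ≤ M * ℓ σ := hK σ hσ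
      _ ≤ M * (C * Real.exp (ε * σ)) := mul_le_mul_of_nonneg_left (hC σ hσ) hM
      _ = M * C * Real.exp ((0 + ε) * σ) := by rw [zero_add]; ring
  linarith

/-- Theorem 1 as an exclusion: in the window `γ < 1/2` no loop with nonzero circulation can satisfy
both the Kelvin lower bound and the subexponential (zero-entropy, `C^∞`) upper bound. -/
theorem no_circulating_loop_in_window {γ : ℝ} (hγ : γ < 1 / 2) :
    ¬ ∃ (Γ₀ M : ℝ) (ℓ : ℝ → ℝ), Γ₀ ≠ 0 ∧ 0 ≤ M ∧
      (∀ σ : ℝ, 0 ≤ σ → |Γ₀| * Real.exp ((1 - 2 * γ) * σ) ≤ M * ℓ σ) ∧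
      (∀ ε : ℝ, 0 < ε → ∃ C : ℝ, ∀ σ : ℝ, 0 ≤ σ → ℓ σ ≤ C * Real.exp (ε * σ)) := by
  rintro ⟨Γ₀, M, ℓ, hΓ₀, hM, hK, hY⟩
  have := half_le_of_kelvin_yomdin_smooth ℓ hΓ₀ hM hK hY
  linarith

/-- **Regularity ceiling.** From `k(1-2γ) ≤ ρ` with `γ < 1/2`, `k ≥ 1`: `ρ > 0` (some node is
spectrally incoming) and `k ≤ ρ/(1-2γ)`. -/
theorem regularity_bound {γ ρ k : ℝ} (hγ : γ < 1 / 2) (hk : 1 ≤ k) (h : k * (1 - 2 * γ) ≤ ρ) :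
    0 < ρ ∧ k ≤ ρ / (1 - 2 * γ) := by
  have hpos : 0 < 1 - 2 * γ := by linarith
  refine ⟨?_, ?_⟩
  · have : 0 < k * (1 - 2 * γ) := mul_pos (by linarith) hpos
    linarith
  · rw [le_div_iff₀ hpos]; exact h

/-- **Corollary 2.1** ([CIV, Thm 3.10] without analyticity or finiteness, for `C¹` profiles): if every
node is spectrally non-incoming (`ρ ≤ 0`, e.g. under the local outgoing property, which makes
`sym ∇V(y*) ⪰ 0`), the ceiling is violated already for `k = 1`: no such profile with `curl U ≢ 0`. -/
theorem no_profile_of_spectrally_nonincoming {γ ρ k : ℝ} (hγ : γ < 1 / 2) (hk : 1 ≤ k)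
    (h : k * (1 - 2 * γ) ≤ ρ) (hρ : ρ ≤ 0) : False := by
  have := (regularity_bound hγ hk h).1
  linarith

/-- **Corollary 2.2 (i).** At a node with `Ω(y*) ≠ 0` (eigenvalue `γ+1` on `Ω(y*)`, the other two
summing to `2γ-1` since `tr ∇V = 3γ`), a complex pair has real part `(2γ-1)/2 > -k(1-2γ)`: such a
node is never the compressive node of Theorem 2. -/
theorem complexPair_not_compressive {γ k : ℝ} (hγ : γ < 1 / 2) (hk : 1 ≤ k) :
    -(k * (1 - 2 * γ)) < (2 * γ - 1) / 2 := by
  nlinarith [mul_pos (show (0 : ℝ) < k - 1 / 2 by linarith) (show (0 : ℝ) < 1 - 2 * γ by linarith)]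

/-- **Corollary 2.2 (ii).** If the pair is real, `λ₂ + λ₃ = 2γ - 1` and `λ₂ ≤ -k(1-2γ)` force
`λ₃ ≥ (k-1)(1-2γ) ≥ 0`: the compressive node carrying vorticity is a real saddle. -/
theorem realPair_at_compressive_node {γ k l₂ l₃ : ℝ} (hγ : γ < 1 / 2) (hk : 1 ≤ k)
    (hsum : l₂ + l₃ = 2 * γ - 1) (h₂ : l₂ ≤ -(k * (1 - 2 * γ))) :
    (k - 1) * (1 - 2 * γ) ≤ l₃ ∧ 0 ≤ l₃ := by
  have hprod : 0 ≤ (k - 1) * (1 - 2 * γ) := mul_nonneg (by linarith) (by linarith)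
  constructor
  · nlinarith
  · nlinarith

/-- **§4 of the note: the exact singular swirl.** For every `γ ≠ 0` the planar field
`U = κ r^{β} e_θ`, `β = 1 - 1/γ`, solves the angular profile equation `(1-γ) f + γ r f' = 0`
(`f = κ r^β`, `r f' = κ β r · r^{β-1}`); written out with `Real.rpow` for `r > 0`. -/
theorem powerLawSwirl_profile {γ κ r : ℝ} (hγ : γ ≠ 0) (hr : 0 < r) :
    (1 - γ) * (κ * r ^ (1 - 1 / γ)) + γ * (r * (κ * ((1 - 1 / γ) * r ^ (1 - 1 / γ - 1)))) = 0 := by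
  have h1 : r * r ^ (1 - 1 / γ - 1) = r ^ (1 - 1 / γ) := by
    conv_rhs => rw [show (1 - 1 / γ : ℝ) = 1 + (1 - 1 / γ - 1) by ring, Real.rpow_add hr,
      Real.rpow_one]
  have h2 : (1 - γ) + γ * (1 - 1 / γ) = 0 := by field_simp; ring
  calc (1 - γ) * (κ * r ^ (1 - 1 / γ)) + γ * (r * (κ * ((1 - 1 / γ) * r ^ (1 - 1 / γ - 1))))
      = ((1 - γ) + γ * (1 - 1 / γ)) * (κ * r ^ (1 - 1 / γ)) := by rw [← h1]; ring
    _ = 0 := by rw [h2, zero_mul]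

/-- The swirl's circulation around the circle of radius `r(τ) = r₀ e^{γτ}` is `2πκ r(τ)^{1+β}`, growing
at rate `γ(1+β) = 2γ - 1` — exactly the self-similar Kelvin law. -/
theorem powerLawSwirl_kelvin_exponent {γ : ℝ} (hγ : γ ≠ 0) : γ * (1 + (1 - 1 / γ)) = 2 * γ - 1 := by
  field_simp; ring

/-- The swirl's vorticity exponent is `β - 1 = -1/γ` (the far-field class `|Ω| ≲ |y|^{-1/γ}` of [CIV,
(3.6)]), and for `0 < γ < 1` the velocity exponent `β = 1 - 1/γ` is negative: `U` is unbounded at the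
node — the smoothness hypothesis of Theorems 1–2 is exactly what fails. -/
theorem powerLawSwirl_exponent_neg {γ : ℝ} (h0 : 0 < γ) (h1 : γ < 1) :
    (1 - 1 / γ) - 1 = -(1 / γ) ∧ 1 - 1 / γ < 0 := by
  refine ⟨by ring, ?_⟩
  have : 1 < 1 / γ := by rw [lt_div_iff₀ h0]; linarith
  linarith

end Summit.NavierStokesRegularity.NavierStokesRegularity.Theorems
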